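import Summits.Ventures.Crystal3D.Theorems.StickyWulffConstantGenericWallFloorAtIrrational
import Summits.Ventures.Crystal3D.Theorems.StickyWulffConstantGenericWallFloorStarPairFar
import HarnessLib

/-!
# `GenericWallFloor` per pair modulo EXACTLY the two certified computations `ExactOnly`(C12-55) and `StarPairFar`
# (crux `GenericWallFloor`, stmt-Ventures-19480, line `WallLedgerG`)

HONEST FRAMING. Venture `Summits/Ventures/Crystal3D` (cell `crystal3d-full`), helper `--supports` the crux
`GenericWallFloor` of `route-Ventures-StickyWulffConstant`, REGISTERED line `WallLedgerG`, open stub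
`stub_twoSlabAdhesion`.  Rung credit only; F-C1 not moved; NOT the crux (the ray-aligned Σ3ⁿ chain core and the two
computational inputs remain).

19480-p2 g4's `…GenericWallFloorAtOfLedger` / `…AtIrrational` give the crux's conclusion `GenericWallFloorAt A₁ t₁ A₂ t₂`
(the matrix of the route decl, verbatim, `c₀ = 1`) for every non-chain / ray-separated / word-criterion / irrational pair
modulo the E1 row `ExactOnly`(C12-55) and the stars-only double-end input `StarPairCoaxial` (19480-p1 g5,
`…StarPairCoaxial`).  By `starPairCoaxial_of_far` (`…StarPairFar`, this seat) `StarPairCoaxial` follows from the named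
computational hypothesis `StarPairFar` — lit g13's CERTIFIED exact-rational branch and bound (kit j298152–5, 2048/2048,
FAIL list empty) over the 46 star-only local certificates landed in `…StarPairLocalData1–5` (kernel-checked by
`decide +kernel`).  This file records the four statements with the hypothesis in its CERTIFIED form, so that the
remaining inputs of lane G's general-filling theorem for these pairs are exactly two named computations, both
certified-or-running: `ExactOnly`(C12-55) [E1, cf-p2 lineage A] and `StarPairFar` [lit g13; second lineage wulff-p2 g10]:

* `genericWallFloorAt_nonChain_of_far`, `genericWallFloorAt_irrational_of_far`,
  `genericWallFloorAt_chain_of_far`, `genericWallFloorAt_word_of_far`.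

WHAT THIS IS NOT: not the crux; `StarPairFar` and `ExactOnly`(C12-55) are certified computations, not kernel proofs;
F-C1 not moved.
-/

noncomputable section

namespace Summit.Ventures.Crystal3D.Theorems

open Summit.Ventures.Crystal3D Finset
open Literature.MathematicalPhysics.StatisticalMechanics (fccStacking barlowStacking IsHaggSeq)
open scoped InnerProductSpace

/-- **`GenericWallFloor` for every NON-CHAIN pair, modulo `ExactOnly`(C12-55) and the certified `StarPairFar`.** -/
theorem genericWallFloorAt_nonChain_of_far
    {s₀ : EuclideanSpace ℝ (Fin 3)} (hs₀ : s₀ ∈ fccSlots)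
    (hcert : ExactOnly 0 (fccSlots.filter fun w => 0 < ⟪w, s₀⟫_ℝ)) (hfar : StarPairFar)
    (A₁ : EuclideanSpace ℝ (Fin 3) ≃ₗᵢ[ℝ] EuclideanSpace ℝ (Fin 3)) (t₁ : EuclideanSpace ℝ (Fin 3))
    (A₂ : EuclideanSpace ℝ (Fin 3) ≃ₗᵢ[ℝ] EuclideanSpace ℝ (Fin 3)) (t₂ : EuclideanSpace ℝ (Fin 3))
    (𝓕 : Set (EuclideanSpace ℝ (Fin 3) ≃ₗᵢ[ℝ] EuclideanSpace ℝ (Fin 3))) (hA₁ : A₁ ∈ 𝓕)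
    (havoid : ∀ G ∈ 𝓕, G '' fccStacking 1 (Real.sqrt (2 / 3)) ≠ A₂ '' fccStacking 1 (Real.sqrt (2 / 3)))
    (hclosed : ∀ G ∈ 𝓕, ∀ m : EuclideanSpace ℝ (Fin 3), ‖m‖ = 1 →
      (∀ w ∈ fccSlots, ⟪G w, m⟫_ℝ = 0 ∨ ⟪G w, m⟫_ℝ = Real.sqrt (2 / 3) ∨ ⟪G w, m⟫_ℝ = -Real.sqrt (2 / 3)) →
      ∀ G' : EuclideanSpace ℝ (Fin 3) ≃ₗᵢ[ℝ] EuclideanSpace ℝ (Fin 3),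
        (∀ x, G' x = G x - (2 * ⟪G x, m⟫_ℝ) • m) → G' ∈ 𝓕) :
    GenericWallFloorAt A₁ t₁ A₂ t₂ :=
  genericWallFloorAt_nonChain_of_star hs₀ hcert (starPairCoaxial_of_far hfar) A₁ t₁ A₂ t₂ 𝓕 hA₁ havoid hclosed

/-- **`GenericWallFloor` for every IRRATIONAL pair** (one irrational `√2⟪A₁cᵢ, A₂w⟫`; all pairs outside a countable
family), modulo `ExactOnly`(C12-55) and the certified `StarPairFar`. -/
theorem genericWallFloorAt_irrational_of_far
    {s₀ : EuclideanSpace ℝ (Fin 3)} (hs₀ : s₀ ∈ fccSlots)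
    (hcert : ExactOnly 0 (fccSlots.filter fun w => 0 < ⟪w, s₀⟫_ℝ)) (hfar : StarPairFar)
    (A₁ : EuclideanSpace ℝ (Fin 3) ≃ₗᵢ[ℝ] EuclideanSpace ℝ (Fin 3)) (t₁ : EuclideanSpace ℝ (Fin 3))
    (A₂ : EuclideanSpace ℝ (Fin 3) ≃ₗᵢ[ℝ] EuclideanSpace ℝ (Fin 3)) (t₂ : EuclideanSpace ℝ (Fin 3))
    (hirr : ∃ i : Fin 3, ∃ w ∈ fccSlots, ∀ q : ℚ, Real.sqrt 2 * ⟪A₁ (cubicFrame i), A₂ w⟫_ℝ ≠ (q : ℝ)) :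
    GenericWallFloorAt A₁ t₁ A₂ t₂ :=
  genericWallFloorAt_irrational_of_star hs₀ hcert (starPairCoaxial_of_far hfar) A₁ t₁ A₂ t₂ hirr

open scoped Classical in
/-- **`GenericWallFloor` for every RAY-SEPARATED pair**, modulo `ExactOnly`(C12-55) and the certified `StarPairFar`. -/
theorem genericWallFloorAt_chain_of_far
    {s₀ : EuclideanSpace ℝ (Fin 3)} (hs₀ : s₀ ∈ fccSlots)
    (hcert : ExactOnly 0 (fccSlots.filter fun w => 0 < ⟪w, s₀⟫_ℝ)) (hfar : StarPairFar)
    (A₁ : EuclideanSpace ℝ (Fin 3) ≃ₗᵢ[ℝ] EuclideanSpace ℝ (Fin 3)) (t₁ : EuclideanSpace ℝ (Fin 3))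
    (A₂ : EuclideanSpace ℝ (Fin 3) ≃ₗᵢ[ℝ] EuclideanSpace ℝ (Fin 3)) (t₂ : EuclideanSpace ℝ (Fin 3))
    {u₁ : EuclideanSpace ℝ (Fin 3)} (hu₁ : u₁ ∈ fccSlots)
    (hsteep₁ : Real.sqrt 2 / 2 ≤ ⟪A₁ u₁, EuclideanSpace.single (2 : Fin 3) (1 : ℝ)⟫_ℝ)
    {u₂ : EuclideanSpace ℝ (Fin 3)} (hu₂ : u₂ ∈ fccSlots)
    (hsteep₂ : ⟪A₂ u₂, EuclideanSpace.single (2 : Fin 3) (1 : ℝ)⟫_ℝ ≤ -(Real.sqrt 2 / 2))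
    (hsep : ∀ F₁ ∈ chainFrames (EuclideanSpace.single (2 : Fin 3) (1 : ℝ)) A₁ u₁,
      ∀ F₂ ∈ chainFrames (-EuclideanSpace.single (2 : Fin 3) (1 : ℝ)) A₂ u₂,
      ¬ ∃ (L : EuclideanSpace ℝ (Fin 3) ≃ₗᵢ[ℝ] EuclideanSpace ℝ (Fin 3))
        (s₁ s₂ : EuclideanSpace ℝ (Fin 3)) (σ σ' : ℤ → ℤ), IsHaggSeq σ ∧ IsHaggSeq σ' ∧
        F₁ '' fccStacking 1 (Real.sqrt (2 / 3)) ⊆ (fun p => L p + s₁) '' barlowStacking 1 (Real.sqrt (2 / 3)) σ ∧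
        F₂ '' fccStacking 1 (Real.sqrt (2 / 3)) ⊆ (fun p => L p + s₂) '' barlowStacking 1 (Real.sqrt (2 / 3)) σ') :
    GenericWallFloorAt A₁ t₁ A₂ t₂ :=
  genericWallFloorAt_chain_of_star hs₀ hcert (starPairCoaxial_of_far hfar) A₁ t₁ A₂ t₂ hu₁ hsteep₁ hu₂ hsteep₂ hsep

open scoped Classical in
/-- **`GenericWallFloor` for every chain pair under the WORD CRITERION**, modulo `ExactOnly`(C12-55) and the certified
`StarPairFar`. -/
theorem genericWallFloorAt_word_of_far
    {s₀ : EuclideanSpace ℝ (Fin 3)} (hs₀ : s₀ ∈ fccSlots)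
    (hcert : ExactOnly 0 (fccSlots.filter fun w => 0 < ⟪w, s₀⟫_ℝ)) (hfar : StarPairFar)
    (A₁ : EuclideanSpace ℝ (Fin 3) ≃ₗᵢ[ℝ] EuclideanSpace ℝ (Fin 3)) (t₁ : EuclideanSpace ℝ (Fin 3))
    (A₂ : EuclideanSpace ℝ (Fin 3) ≃ₗᵢ[ℝ] EuclideanSpace ℝ (Fin 3)) (t₂ : EuclideanSpace ℝ (Fin 3))
    {u₁ : EuclideanSpace ℝ (Fin 3)} (hu₁ : u₁ ∈ fccSlots)
    (hsteep₁ : Real.sqrt 2 / 2 ≤ ⟪A₁ u₁, EuclideanSpace.single (2 : Fin 3) (1 : ℝ)⟫_ℝ)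
    {u₂ : EuclideanSpace ℝ (Fin 3)} (hu₂ : u₂ ∈ fccSlots)
    (hsteep₂ : ⟪A₂ u₂, EuclideanSpace.single (2 : Fin 3) (1 : ℝ)⟫_ℝ ≤ -(Real.sqrt 2 / 2))
    (κ : List (EuclideanSpace ℝ (Fin 3)))
    (hκl : ∀ μ ∈ κ, ‖μ‖ = 1 ∧
      ∀ w ∈ fccSlots, ⟪w, μ⟫_ℝ = 0 ∨ ⟪w, μ⟫_ℝ = Real.sqrt (2 / 3) ∨ ⟪w, μ⟫_ℝ = -Real.sqrt (2 / 3))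
    (hκc : List.IsChain (fun μ μ' => ⟪μ, μ'⟫_ℝ = 1 / 3 ∨ ⟪μ, μ'⟫_ℝ = -1 / 3) κ) (hκ2 : 2 ≤ κ.length)
    (hA₂ : A₂ '' fccStacking 1 (Real.sqrt (2 / 3)) = (wordFrame A₁ κ) '' fccStacking 1 (Real.sqrt (2 / 3)))
    (hfirst : ∀ μ, κ.getLast? = some μ → ⟪u₁, μ⟫_ℝ = 0)
    (hlast : ∀ μ, κ.head? = some μ → ⟪A₂ u₂, wordFrame A₁ κ μ⟫_ℝ = 0) :
    GenericWallFloorAt A₁ t₁ A₂ t₂ :=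
  genericWallFloorAt_word_of_star hs₀ hcert (starPairCoaxial_of_far hfar) A₁ t₁ A₂ t₂ hu₁ hsteep₁ hu₂ hsteep₂ κ hκl
    hκc hκ2 hA₂ hfirst hlast

end Summit.Ventures.Crystal3D.Theorems

end
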